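import Summits.CriticalPhenomena.PercolationContinuityZ3.Theorems.SahiAEZeros

/-!
# Densities with zeros in every dimension: product reference measures and arbitrary supports

Support file of the Sahi cell (`prim-sahi`, typer seat, generation 25; `--supports stmt-CriticalPhenomena-4575`).
Theorems only (no definitions, no named facts, no sorries).

`SahiAEZeros.lean` proved that every measurable, a.e.-finite density on `ℝ^ι` (`ι` finite) which is TP₂ on
Lebesgue-almost every pair has a Borel version TP₂ at every pair.  Here (the proofs of `SahiAEPlaneZerosPi.lean`,
generation 24, verbatim with `Fin 2` replaced by `ι`):

* `exists_measurable_tp2_version_of_ae_zeros_pi` — the reference measure `λ` is replaced by any finite product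
  `⊗ ρᵢ` of atomless σ-finite measures on `ℝ` (transport to Lebesgue measure on the open unit cube along the
  coordinatewise quantile maps of `(ρᵢ).toFinite`, apply the theorem to `𝟙_{(0,1)^ι} · (f ∘ T)`, pull back along
  the coordinatewise distribution functions);
* `exists_measurable_tp2_version_of_ae_zeros_restrict_pi` — Lebesgue measure restricted to a product set `∏ Xᵢ`;
* `exists_measurable_supermodular_version_of_ae_support` — ADDITIVE form on an arbitrary support: `S ⊆ ℝ^ι`
  measurable and a sublattice up to a null set of pairs, `φ` supermodular on almost every pair of `S` ⟹ an honest
  measurable sublattice `S' = S` a.e. and a Borel `ψ = φ` a.e. on `S`, supermodular at EVERY pair of `S'`.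

No sorries, no new axioms.
-/

noncomputable section

namespace Summit.CriticalPhenomena.PercolationContinuityZ3.Theorems.SahiAEFourFunctions

open MeasureTheory Set Filter Topology Function ProbabilityTheory
open scoped ENNReal NNReal

variable {ι : Type*} [Fintype ι] [DecidableEq ι]

/-- **The structure theorem for densities with zeros, product reference measures, every dimension.**  For atomless
σ-finite `ρᵢ` on `ℝ` (`ι` finite) and `π = ⊗ ρᵢ`: every measurable, `π`-a.e. finite `f : ℝ^ι → [0, ∞]` which is TP₂ on
`π ⊗ π`-almost every pair has a Borel, everywhere finite version `F = f` `π`-a.e. with `F(x) F(y) ≤ F(x ∧ y) F(x ∨ y)`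
for ALL `x, y`. [this work] -/
theorem exists_measurable_tp2_version_of_ae_zeros_pi (ρ : ι → Measure ℝ) [∀ i, SigmaFinite (ρ i)]
    [∀ i, NullSingletonClass (ρ i)] (f : (ι → ℝ) → ℝ≥0∞) (hf : Measurable f)
    (hfin : ∀ᵐ x ∂Measure.pi ρ, f x ≠ ∞)
    (hMTP : ∀ᵐ q ∂(Measure.pi ρ).prod (Measure.pi ρ), f q.1 * f q.2 ≤ f (q.1 ⊓ q.2) * f (q.1 ⊔ q.2)) :
    ∃ F : (ι → ℝ) → ℝ≥0∞, Measurable F ∧ (∀ x, F x ≠ ∞) ∧ F =ᵐ[Measure.pi ρ] f ∧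
      ∀ x y, F x * F y ≤ F (x ⊓ y) * F (x ⊔ y) := by
  classical
  by_cases h0 : ∃ i, ρ i = 0
  · obtain ⟨i, hi⟩ := h0
    have hpi : Measure.pi ρ = 0 := by
      rw [← Measure.measure_univ_eq_zero, Measure.pi_univ]
      exact Finset.prod_eq_zero (Finset.mem_univ i) (by rw [hi]; rfl)
    refine ⟨fun _ => 0, measurable_const, fun _ => ENNReal.zero_ne_top, ?_, fun _ _ => by simp⟩
    rw [hpi]; exact ae_zero.le (by simp)
  push Not at h0
  haveI : ∀ i, NeZero (ρ i) := fun i => ⟨h0 i⟩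
  set ν : ι → Measure ℝ := fun i => (ρ i).toFinite with hν
  haveI : ∀ i, IsProbabilityMeasure (ν i) := fun i => by rw [hν]; infer_instance
  haveI : ∀ i, NullSingletonClass (ν i) := fun i =>
    ⟨fun x => toFinite_absolutelyContinuous (ρ i) (measure_singleton x)⟩
  have hρν : Measure.pi ρ ≪ Measure.pi ν := pi_absolutelyContinuous_pi_toFinite ρ
  have hνρ : Measure.pi ν ≪ Measure.pi ρ := pi_toFinite_absolutelyContinuous_pi ρ
  -- the square and the transport maps
  set U : Set (ι → ℝ) := Set.pi univ fun _ => Ioo (0 : ℝ) 1 with hU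
  have mU : MeasurableSet U := MeasurableSet.univ_pi fun _ => measurableSet_Ioo
  set μ₁ : Measure (ι → ℝ) := (volume : Measure (ι → ℝ)).restrict U with hμ₁
  have hμ₁pi : μ₁ = Measure.pi fun _ : ι => (volume : Measure ℝ).restrict (Ioo (0 : ℝ) 1) := by
    rw [hμ₁, hU, volume_pi, Measure.restrict_pi_pi]
  set T : (ι → ℝ) → (ι → ℝ) := fun u i => rqe (ν i) (u i) with hT
  set R : (ι → ℝ) → (ι → ℝ) := fun x i => cdf (ν i) (x i) with hR
  have hTmp : MeasurePreserving T μ₁ (Measure.pi ν) := by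
    rw [hμ₁pi]
    exact measurePreserving_pi _ _ fun i => measurePreserving_rqe (ν i)
  have hT_meas : Measurable T := hTmp.measurable
  have hR_meas : Measurable R :=
    measurable_pi_iff.2 fun i => (monotone_cdf (ν i)).measurable.comp (measurable_pi_apply i)
  have haeU : ∀ᵐ u ∂μ₁, u ∈ U := ae_restrict_mem mU
  have hRT : ∀ᵐ u ∂μ₁, R (T u) = u := by
    filter_upwards [haeU] with u hu
    funext i
    have hui := Set.mem_univ_pi.1 hu i
    show cdf (ν i) (rqe (ν i) (u i)) = u i
    rw [rqe_of_mem _ hui, cdf_rq_eq _ hui]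
  have hRlat : ∀ x y, R (x ⊓ y) = R x ⊓ R y ∧ R (x ⊔ y) = R x ⊔ R y := fun x y =>
    ⟨funext fun i => (monotone_cdf (ν i)).map_inf (x i) (y i),
      funext fun i => (monotone_cdf (ν i)).map_sup (x i) (y i)⟩
  have hTlat : ∀ x ∈ U, ∀ y ∈ U, T (x ⊓ y) = T x ⊓ T y ∧ T (x ⊔ y) = T x ⊔ T y := fun x hx y hy =>
    ⟨funext fun i => (monotoneOn_rqe (ν i)).map_inf (Set.mem_univ_pi.1 hx i) (Set.mem_univ_pi.1 hy i),
      funext fun i => (monotoneOn_rqe (ν i)).map_sup (Set.mem_univ_pi.1 hx i) (Set.mem_univ_pi.1 hy i)⟩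
  have hUinf : ∀ x ∈ U, ∀ y ∈ U, x ⊓ y ∈ U := fun x hx y hy => Set.mem_univ_pi.2 fun i =>
    ⟨lt_min (Set.mem_univ_pi.1 hx i).1 (Set.mem_univ_pi.1 hy i).1, (min_le_left _ _).trans_lt (Set.mem_univ_pi.1 hx i).2⟩
  have hUsup : ∀ x ∈ U, ∀ y ∈ U, x ⊔ y ∈ U := fun x hx y hy => Set.mem_univ_pi.2 fun i =>
    ⟨(Set.mem_univ_pi.1 hx i).1.trans_le (le_max_left _ _), max_lt (Set.mem_univ_pi.1 hx i).2 (Set.mem_univ_pi.1 hy i).2⟩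
  -- the transported density on the square, extended by zero
  set g : (ι → ℝ) → ℝ≥0∞ := U.indicator (f ∘ T) with hg
  have hgm : Measurable g := (hf.comp hT_meas).indicator mU
  have hqmp : Measure.QuasiMeasurePreserving T μ₁ (Measure.pi ρ) := ⟨hT_meas, by rw [hTmp.map_eq]; exact hνρ⟩
  have hqmp2 := MeasureTheory.QuasiMeasurePreserving.prodMap hqmp hqmp
  have hgfin : ∀ᵐ x ∂(volume : Measure (ι → ℝ)), g x ≠ ∞ := by
    have h1 : ∀ᵐ u ∂μ₁, f (T u) ≠ ∞ := hqmp.ae hfin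
    rw [hμ₁, ae_restrict_iff' mU] at h1
    filter_upwards [h1] with x hx
    by_cases hxU : x ∈ U
    · rw [hg, Set.indicator_of_mem hxU]; exact hx hxU
    · rw [hg, Set.indicator_of_notMem hxU]; exact ENNReal.zero_ne_top
  have hgMTP : ∀ᵐ q ∂(volume : Measure (ι → ℝ)).prod volume, g q.1 * g q.2 ≤ g (q.1 ⊓ q.2) * g (q.1 ⊔ q.2) := by
    have h1 : ∀ᵐ q ∂μ₁.prod μ₁, f (T q.1) * f (T q.2) ≤ f (T (q.1 ⊓ q.2)) * f (T (q.1 ⊔ q.2)) := by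
      have haeU2 : ∀ᵐ p ∂μ₁.prod μ₁, p.1 ∈ U ∧ p.2 ∈ U := by
        filter_upwards [(Measure.quasiMeasurePreserving_fst (μ := μ₁) (ν := μ₁)).ae haeU,
          (Measure.quasiMeasurePreserving_snd (μ := μ₁) (ν := μ₁)).ae haeU] with p hp1 hp2 using ⟨hp1, hp2⟩
      filter_upwards [hqmp2.ae hMTP, haeU2] with q hq hqU
      rw [(hTlat q.1 hqU.1 q.2 hqU.2).1, (hTlat q.1 hqU.1 q.2 hqU.2).2]
      exact hq
    rw [hμ₁, Measure.prod_restrict, ae_restrict_iff' (mU.prod mU)] at h1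
    filter_upwards [h1] with q hq
    by_cases h1U : q.1 ∈ U
    · by_cases h2U : q.2 ∈ U
      · simp only [hg, Set.indicator_of_mem h1U, Set.indicator_of_mem h2U, Set.indicator_of_mem (hUinf _ h1U _ h2U),
          Set.indicator_of_mem (hUsup _ h1U _ h2U), Function.comp_apply]
        exact hq ⟨h1U, h2U⟩
      · rw [hg, Set.indicator_of_notMem h2U, mul_zero]; exact zero_le
    · rw [hg, Set.indicator_of_notMem h1U, zero_mul]; exact zero_le
  obtain ⟨G, hGm, hGb, hGae, hGtp⟩ := exists_measurable_tp2_version_of_ae_zeros g hgm hgfin hgMTP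
  refine ⟨G ∘ R, hGm.comp hR_meas, fun x => hGb (R x), ?_, fun x y => ?_⟩
  · have hGg : ∀ᵐ u ∂μ₁, G u = f (T u) := by
      rw [hμ₁, ae_restrict_iff' mU]
      filter_upwards [hGae] with u hu huU
      rw [hu, hg, Set.indicator_of_mem huU, Function.comp_apply]
    have h1 : ∀ᵐ u ∂μ₁, G (R (T u)) = f (T u) := by
      filter_upwards [hGg, hRT] with u hu huR
      rw [huR, hu]
    have h2 : ∀ᵐ y ∂μ₁.map T, G (R y) = f y :=
      (ae_map_iff hT_meas.aemeasurable (measurableSet_eq_fun (hGm.comp hR_meas) hf)).2 h1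
    rw [hTmp.map_eq] at h2
    exact hρν.ae_le h2
  · simp only [Function.comp_apply]
    rw [(hRlat x y).1, (hRlat x y).2]
    exact hGtp (R x) (R y)

/-- **Lebesgue measure restricted to a product set** `∏ Xᵢ ⊆ ℝ^ι` (any measurable `Xᵢ`): densities with zeros, TP₂
on almost every pair of the product set, have Borel everywhere-TP₂ versions. [this work] -/
theorem exists_measurable_tp2_version_of_ae_zeros_restrict_pi (X : ι → Set ℝ)
    (f : (ι → ℝ) → ℝ≥0∞) (hf : Measurable f)
    (hfin : ∀ᵐ x ∂(volume : Measure (ι → ℝ)).restrict (Set.pi univ X), f x ≠ ∞)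
    (hMTP : ∀ᵐ q ∂((volume : Measure (ι → ℝ)).restrict (Set.pi univ X)).prod
      ((volume : Measure (ι → ℝ)).restrict (Set.pi univ X)), f q.1 * f q.2 ≤ f (q.1 ⊓ q.2) * f (q.1 ⊔ q.2)) :
    ∃ F : (ι → ℝ) → ℝ≥0∞, Measurable F ∧ (∀ x, F x ≠ ∞) ∧
      F =ᵐ[(volume : Measure (ι → ℝ)).restrict (Set.pi univ X)] f ∧ ∀ x y, F x * F y ≤ F (x ⊓ y) * F (x ⊔ y) := by
  rw [volume_pi, Measure.restrict_pi_pi] at hfin hMTP ⊢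
  exact exists_measurable_tp2_version_of_ae_zeros_pi (fun i => (volume : Measure ℝ).restrict (X i)) f hf hfin hMTP

/-- **Additive form on an arbitrary support, every dimension.**  Let `S ⊆ ℝ^ι` be measurable and a sublattice up to
a Lebesgue-null set of pairs, and `φ : ℝ^ι → ℝ` measurable and supermodular on almost every pair of `S`.  Then there
are a measurable honest sublattice `S'`, `S' = S` almost everywhere, and a Borel `ψ`, `ψ = φ` almost everywhere on `S`,
with `ψ(x) + ψ(y) ≤ ψ(x ∧ y) + ψ(x ∨ y)` for ALL `x, y ∈ S'`. [this work] -/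
theorem exists_measurable_supermodular_version_of_ae_support (S : Set (ι → ℝ)) (hS : MeasurableSet S)
    (φ : (ι → ℝ) → ℝ) (hφ : Measurable φ)
    (hSl : ∀ᵐ q ∂(volume : Measure (ι → ℝ)).prod volume, q.1 ∈ S → q.2 ∈ S → q.1 ⊓ q.2 ∈ S ∧ q.1 ⊔ q.2 ∈ S)
    (hsm : ∀ᵐ q ∂(volume : Measure (ι → ℝ)).prod volume,
      q.1 ∈ S → q.2 ∈ S → φ q.1 + φ q.2 ≤ φ (q.1 ⊓ q.2) + φ (q.1 ⊔ q.2)) :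
    ∃ S' : Set (ι → ℝ), ∃ ψ : (ι → ℝ) → ℝ, MeasurableSet S' ∧ S' =ᵐ[(volume : Measure (ι → ℝ))] S ∧
      (∀ x ∈ S', ∀ y ∈ S', x ⊓ y ∈ S' ∧ x ⊔ y ∈ S') ∧ Measurable ψ ∧
      (∀ᵐ x ∂(volume : Measure (ι → ℝ)), x ∈ S → ψ x = φ x) ∧
      ∀ x ∈ S', ∀ y ∈ S', ψ x + ψ y ≤ ψ (x ⊓ y) + ψ (x ⊔ y) := by
  set f : (ι → ℝ) → ℝ≥0∞ := S.indicator fun x => ENNReal.ofReal (Real.exp (φ x)) with hfdef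
  have hfm : Measurable f := (ENNReal.measurable_ofReal.comp (Real.measurable_exp.comp hφ)).indicator hS
  have hfin : ∀ᵐ x ∂(volume : Measure (ι → ℝ)), f x ≠ ∞ := Eventually.of_forall fun x => by
    by_cases hx : x ∈ S
    · rw [hfdef, Set.indicator_of_mem hx]; exact ENNReal.ofReal_ne_top
    · rw [hfdef, Set.indicator_of_notMem hx]; exact ENNReal.zero_ne_top
  have hfS : ∀ x, f x ≠ 0 ↔ x ∈ S := fun x => by
    by_cases hx : x ∈ S
    · rw [hfdef, Set.indicator_of_mem hx]; exact ⟨fun _ => hx, fun _ => (ENNReal.ofReal_pos.2 (Real.exp_pos _)).ne'⟩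
    · rw [hfdef, Set.indicator_of_notMem hx]; exact ⟨fun h => absurd rfl h, fun h => absurd h hx⟩
  have hMTP : ∀ᵐ q ∂(volume : Measure (ι → ℝ)).prod volume, f q.1 * f q.2 ≤ f (q.1 ⊓ q.2) * f (q.1 ⊔ q.2) := by
    filter_upwards [hSl, hsm] with q hq hq'
    by_cases h1 : q.1 ∈ S
    · by_cases h2 : q.2 ∈ S
      · obtain ⟨hi, hs⟩ := hq h1 h2
        rw [hfdef, Set.indicator_of_mem h1, Set.indicator_of_mem h2, Set.indicator_of_mem hi, Set.indicator_of_mem hs,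
          ← ENNReal.ofReal_mul (Real.exp_pos _).le, ← ENNReal.ofReal_mul (Real.exp_pos _).le, ← Real.exp_add,
          ← Real.exp_add]
        exact ENNReal.ofReal_le_ofReal (Real.exp_le_exp.2 (hq' h1 h2))
      · rw [hfdef, Set.indicator_of_notMem h2, mul_zero]; exact zero_le
    · rw [hfdef, Set.indicator_of_notMem h1, zero_mul]; exact zero_le
  obtain ⟨F, hFm, hFb, hFf, hFtp⟩ := exists_measurable_tp2_version_of_ae_zeros f hfm hfin hMTP
  set S' : Set (ι → ℝ) := {x | F x ≠ 0} with hS'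
  have mS' : MeasurableSet S' := (hFm (measurableSet_singleton 0)).compl
  have hlat : ∀ x ∈ S', ∀ y ∈ S', x ⊓ y ∈ S' ∧ x ⊔ y ∈ S' := fun x hx y hy => by
    have hL : F x * F y ≠ 0 := mul_ne_zero hx hy
    have hR : F (x ⊓ y) * F (x ⊔ y) ≠ 0 := fun h => hL (le_zero_iff.1 (h ▸ hFtp x y))
    exact ⟨(mul_ne_zero_iff.1 hR).1, (mul_ne_zero_iff.1 hR).2⟩
  have hpos : ∀ x ∈ S', 0 < (F x).toReal := fun x hx => ENNReal.toReal_pos hx (hFb x)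
  refine ⟨S', fun x => Real.log (F x).toReal, mS', ?_, hlat, Real.measurable_log.comp (ENNReal.measurable_toReal.comp hFm),
    ?_, fun x hx y hy => ?_⟩
  · filter_upwards [hFf] with x hx
    show (x ∈ S') = (x ∈ S)
    rw [Set.mem_setOf_eq, hx, hfS x]
  · filter_upwards [hFf] with x hx hxS
    show Real.log (F x).toReal = φ x
    rw [hx, hfdef, Set.indicator_of_mem hxS, ENNReal.toReal_ofReal (Real.exp_pos _).le, Real.log_exp]
  · have h := hFtp x y
    obtain ⟨hi, hs⟩ := hlat x hx y hy
    have hL : (F x * F y).toReal ≤ (F (x ⊓ y) * F (x ⊔ y)).toReal :=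
      ENNReal.toReal_mono (ENNReal.mul_ne_top (hFb _) (hFb _)) h
    rw [ENNReal.toReal_mul, ENNReal.toReal_mul] at hL
    rw [← Real.log_mul (hpos x hx).ne' (hpos y hy).ne', ← Real.log_mul (hpos _ hi).ne' (hpos _ hs).ne']
    exact Real.log_le_log (mul_pos (hpos x hx) (hpos y hy)) hL

end Summit.CriticalPhenomena.PercolationContinuityZ3.Theorems.SahiAEFourFunctions
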